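import Literature.NumberTheory.Automorphic.HilbertRepOrthogonalDecomposition
import Literature.NumberTheory.Automorphic.AutomorphicQuotientErgodic
import Literature.NumberTheory.Automorphic.AutomorphicSpectrumCompactQuotient
import Literature.NumberTheory.Automorphic.HilbertRepSpectrumProofs
import Literature.NumberTheory.Rogawski1990.CurveCohomologicalSpectrum
import Summits.HodgeConjecture.HodgeConjecture.Theorems.HLiu418S1BettiSliceExclusion
import Literature.NumberTheory.Automorphic.AdelicUnitaryGroupDatum
import HarnessLib

/-!
# Crux `HLiu418`, floor 0, programme P5 — THE GENERIC MULTIPLICITY CRITERION behind the letter E1₂ (`Rogawski1990.curveMultiplicityLeOne`)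

Cell hodgecm-mathlib (D-0151), crux item `HLiu418` = stmt-HodgeConjecture-24832; PLAN v2 (F0P5-plan (g2), 2026-08-31) §4 B3, pen A-p04 (g21);
PROOF lane `--supports stmt-HodgeConjecture-24832 --as helper`; THEOREMS ONLY (no definition, no instance, no notation, no named fact, no `sorry`);
count-neutral (it neither adds nor discharges a printed citation).  Census: `A-provers/A-p04/g21/ENGINE/CENSUS-engine-E1E3.v1.A-p04g21.md` §2.

WHAT.  The letter E1₂ says: for every discrete automorphic representation `P` of the anisotropic unitary group `U(H)` in two variables,
`multiplicity (R_μ) P ≤ 1`.  This file records, ONCE, the Gelbart–Dixmier dictionary between that spelling and the spellings an ENGINE emits,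
for ANY adelic group datum `𝒢` whose regular representation `R_μ = 𝒢.rightRegular μ` is discretely decomposable (§1), and then at the letter
binders of `curveMultiplicityLeOne` (§2, where discrete decomposability holds because the quotient is compact — anisotropy from the
definiteness clause, [GelfandGraevPiatetskiShapiro1969, Ch. 1 §2]):

* §1 (generic `𝒢`, `μ`):  «`∀ P, multiplicity R_μ P ≤ 1`» ⟺ `R_μ.HasMultiplicityOne` (★ `hasMultiplicityOne_iff_multiplicity_le_one_holds`,
  [Dixmier1977, §5.4]) ⟺ «two unitarily equivalent discrete `P, P′` have the same space» ⟺ (discretely decomposable) «two ORTHOGONAL discrete `P, P′` are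
  never unitarily equivalent» ⟺ «SOME orthogonal decomposition of `L²` into irreducibles has pairwise inequivalent members» ⟺ «EVERY such
  decomposition has» (★ `IsUnitary.hasMultiplicityOne_iff_set_pairwise`, ★ `IsUnitary.exists_orthogonalDecomposition_of_isDiscretelyDecomposable`,
  [Dixmier1977, 5.4.1, 5.4.6]) ⟺ the same with the members ∕ the pair restricted to DIMENSION `≠ 1` (one-dimensional constituents occur once by
  ergodicity: ★ `AdelicGroupData.closedSubrep_eq_of_finrank_eq_one` — the reduction of ★ `QuaternionUnitsMultiplicityOneCriterion` for `D^×`,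
  [Gelbart1975, Thm. 10.10, proof p. 158]).
* §2 (the P5 datum): `curveMultiplicityLeOne` ⟺ «for the data of the letter, no two orthogonal discrete automorphic representations of `U(H)` of
  dimension `≠ 1` are unitarily equivalent» — the shape a trace-formula comparison delivers ([Gelbart1975, Thm. 10.10]; [Rogawski1990, §11,
  §14.6]); and the pointwise form at fixed `(L, ι, H, …, μ)`.

References: [Dixmier1977] J. Dixmier, *C*-algebras* (1977), §5.4 (5.4.1, 5.4.4, 5.4.6).  [Gelbart1975] S. Gelbart, *Automorphic forms on adele
groups* (1975), §10, Thm. 10.10.  [GelfandGraevPiatetskiShapiro1969] Ch. 1 §2.  [DeitmarEchterhoff2014] Thm. 9.2.2.  [Rogawski1990] §11, §14.6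
(NOT used: only the shape of its output is named).
-/

set_option autoImplicit false
-- the mandated namespace has the single-problem summit's repeated segment (`HodgeConjecture.HodgeConjecture`)
set_option linter.dupNamespace false

noncomputable section

namespace Summit.HodgeConjecture.HodgeConjecture.Cruxes.HLiu418.E1Criterion

open NumberField NumberField.InfinitePlace MeasureTheory
open scoped Matrix ComplexOrder
open Literature.NumberTheory.Automorphic Literature.NumberTheory.Automorphic.UnitaryGroup
open ContRepresentation

universe u

/-! ## §1 The dictionary, for any adelic group datum -/

section Generic

variable {K : Type} [Field K] [NumberField K] (𝒢 : AdelicGroupData.{u} K)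
  (μ : Measure 𝒢.automorphicQuotient) [𝒢.IsAutomorphicMeasure μ]

/-- The underlying closed subspace of a discrete automorphic representation is non-zero (topological irreducibility includes
non-triviality). [cite: Dixmier1977, §5.4] -/
theorem space_toSubmodule_ne_bot (P : DiscreteAutomorphicRep 𝒢 μ) : P.space.toSubmodule ≠ ⊥ := by
  have h := ((isTopIrreducible_iff _).mp P.irreducible).1
  exact Submodule.nontrivial_iff_ne_bot.mp h

/-- **E1-shape ⟺ multiplicity one.**  «Every discrete automorphic `P` has `multiplicity (R_μ) P ≤ 1`» iff the regular representation
`R_μ` has multiplicity one (two unitarily equivalent irreducible closed invariant subspaces coincide).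
[cite: Dixmier1977, §5.4] [cite: DeitmarEchterhoff2014, Cor. 6.1.9] -/
theorem forall_multiplicity_le_one_iff_hasMultiplicityOne :
    (∀ P : DiscreteAutomorphicRep 𝒢 μ, (𝒢.rightRegular μ).multiplicity P.space.toContRep ≤ 1) ↔
      (𝒢.rightRegular μ).HasMultiplicityOne := by
  rw [hasMultiplicityOne_iff_multiplicity_le_one_holds (𝒢.isUnitary_rightRegular μ)]
  exact ⟨fun h W hW => h ⟨W, hW⟩, fun h P => h P.space P.irreducible⟩

/-- **E1-shape ⟺ «equivalent discrete `P, P′` have the same space»** (hence are equal, ★ `DiscreteAutomorphicRep.ext'`).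
[cite: Dixmier1977, §5.4] -/
theorem forall_multiplicity_le_one_iff_forall_space_eq :
    (∀ P : DiscreteAutomorphicRep 𝒢 μ, (𝒢.rightRegular μ).multiplicity P.space.toContRep ≤ 1) ↔
      ∀ P P' : DiscreteAutomorphicRep 𝒢 μ, AreUnitarilyEquivalent P.space.toContRep P'.space.toContRep → P.space = P'.space := by
  rw [forall_multiplicity_le_one_iff_hasMultiplicityOne]
  exact ⟨fun h P P' he => h P.space P'.space P.irreducible P'.irreducible he, fun h W W' hW hW' he => h ⟨W, hW⟩ ⟨W', hW'⟩ he⟩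

/-- **E1-shape ⟺ «orthogonal discrete `P, P′` are inequivalent»** (for a discretely decomposable regular representation).
`→`: equivalent `P, P′` are equal, and a non-zero subspace is not orthogonal to itself; `←`: an orthogonal decomposition into irreducibles
exists ([Dixmier1977, 5.4.1]) and its members are then pairwise inequivalent, which is multiplicity one ([Dixmier1977, 5.4.6]).
[cite: Dixmier1977, 5.4.1 and 5.4.6] -/
theorem forall_multiplicity_le_one_iff_forall_isOrtho (hd : (𝒢.rightRegular μ).IsDiscretelyDecomposable) :
    (∀ P : DiscreteAutomorphicRep 𝒢 μ, (𝒢.rightRegular μ).multiplicity P.space.toContRep ≤ 1) ↔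
      ∀ P P' : DiscreteAutomorphicRep 𝒢 μ, P.space.toSubmodule ⟂ P'.space.toSubmodule →
        ¬ AreUnitarilyEquivalent P.space.toContRep P'.space.toContRep := by
  constructor
  · intro h P P' hperp he
    have hPP' : P.space = P'.space := (forall_multiplicity_le_one_iff_forall_space_eq 𝒢 μ).mp h P P' he
    rw [← hPP'] at hperp
    exact space_toSubmodule_ne_bot 𝒢 μ P (Submodule.isOrtho_self.mp hperp)
  · intro h
    rw [forall_multiplicity_le_one_iff_hasMultiplicityOne]
    obtain ⟨S, hirr, horth, hdense⟩ :=
      (𝒢.isUnitary_rightRegular μ).exists_orthogonalDecomposition_of_isDiscretelyDecomposable hd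
    exact ((𝒢.isUnitary_rightRegular μ).hasMultiplicityOne_iff_set_pairwise hirr horth hdense).mpr
      fun W hW W' hW' hne => h ⟨W, hirr W hW⟩ ⟨W', hirr W' hW'⟩ (horth hW hW' hne)

/-- **E1-shape ⟺ SOME orthogonal irreducible decomposition of `L²` has pairwise inequivalent members** (discretely decomposable case).
[cite: Dixmier1977, 5.4.1 and 5.4.6] -/
theorem forall_multiplicity_le_one_iff_exists_decomposition (hd : (𝒢.rightRegular μ).IsDiscretelyDecomposable) :
    (∀ P : DiscreteAutomorphicRep 𝒢 μ, (𝒢.rightRegular μ).multiplicity P.space.toContRep ≤ 1) ↔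
      ∃ S : Set (ClosedSubrep (𝒢.rightRegular μ)), (∀ W ∈ S, W.toContRep.IsTopIrreducible) ∧
        S.Pairwise (fun W W' => W.toSubmodule ⟂ W'.toSubmodule) ∧ ClosedSubrep.iSupClosure S = ⊤ ∧
        S.Pairwise (fun W W' => ¬ AreUnitarilyEquivalent W.toContRep W'.toContRep) := by
  rw [forall_multiplicity_le_one_iff_hasMultiplicityOne]
  exact (𝒢.isUnitary_rightRegular μ).hasMultiplicityOne_iff_exists_orthogonalDecomposition hd

/-- **E1-shape ⟺ EVERY orthogonal irreducible decomposition of `L²` has pairwise inequivalent members** (discretely decomposable case).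
[cite: Dixmier1977, 5.4.1 and 5.4.6] -/
theorem forall_multiplicity_le_one_iff_forall_decomposition (hd : (𝒢.rightRegular μ).IsDiscretelyDecomposable) :
    (∀ P : DiscreteAutomorphicRep 𝒢 μ, (𝒢.rightRegular μ).multiplicity P.space.toContRep ≤ 1) ↔
      ∀ S : Set (ClosedSubrep (𝒢.rightRegular μ)), (∀ W ∈ S, W.toContRep.IsTopIrreducible) →
        S.Pairwise (fun W W' => W.toSubmodule ⟂ W'.toSubmodule) → ClosedSubrep.iSupClosure S = ⊤ →
        S.Pairwise (fun W W' => ¬ AreUnitarilyEquivalent W.toContRep W'.toContRep) := by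
  rw [forall_multiplicity_le_one_iff_hasMultiplicityOne]
  constructor
  · intro h S hirr horth hdense
    exact ((𝒢.isUnitary_rightRegular μ).hasMultiplicityOne_iff_set_pairwise hirr horth hdense).mp h
  · intro h
    obtain ⟨S, hirr, horth, hdense⟩ :=
      (𝒢.isUnitary_rightRegular μ).exists_orthogonalDecomposition_of_isDiscretelyDecomposable hd
    exact ((𝒢.isUnitary_rightRegular μ).hasMultiplicityOne_iff_set_pairwise hirr horth hdense).mpr (h S hirr horth hdense)

variable [LocallyCompactSpace 𝒢.Adelic] [SecondCountableTopology 𝒢.Adelic]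

/-- In a family of irreducible closed invariant subspaces of `L²`, pairwise inequivalence of the members of dimension `≠ 1` gives pairwise
inequivalence of all members: a one-dimensional irreducible constituent is equivalent to no other closed invariant subspace
(★ `AdelicGroupData.closedSubrep_eq_of_finrank_eq_one`, ergodicity). [cite: Gelbart1975, Thm. 10.10 (proof, p. 158)] -/
private theorem pairwise_of_finrank_ne_one {S : Set (ClosedSubrep (𝒢.rightRegular μ))} (hirr : ∀ W ∈ S, W.toContRep.IsTopIrreducible)
    (h : S.Pairwise fun W W' => Module.finrank ℂ W.toSubmodule ≠ 1 → Module.finrank ℂ W'.toSubmodule ≠ 1 →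
      ¬ AreUnitarilyEquivalent W.toContRep W'.toContRep) :
    S.Pairwise fun W W' => ¬ AreUnitarilyEquivalent W.toContRep W'.toContRep := by
  intro W hW W' hW' hWW' he
  by_cases h1 : Module.finrank ℂ W.toSubmodule = 1
  · exact hWW' (𝒢.closedSubrep_eq_of_finrank_eq_one μ (hirr W hW) h1 he)
  by_cases h1' : Module.finrank ℂ W'.toSubmodule = 1
  · exact hWW' (𝒢.closedSubrep_eq_of_finrank_eq_one μ (hirr W' hW') h1' he.symm).symm
  exact h hW hW' hWW' h1 h1' he

/-- **Gelbart's reduction to dimension `≠ 1`.**  E1-shape ⟺ SOME orthogonal irreducible decomposition of `L²` whose members OF DIMENSION `≠ 1`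
are pairwise inequivalent (the one-dimensional constituents occur exactly once, by ergodicity of `G(𝔸_K)` on the automorphic quotient).
[cite: Gelbart1975, Thm. 10.10 (proof, p. 158)] [cite: Dixmier1977, 5.4.6] -/
theorem forall_multiplicity_le_one_iff_exists_decomposition_finrank_ne_one (hd : (𝒢.rightRegular μ).IsDiscretelyDecomposable) :
    (∀ P : DiscreteAutomorphicRep 𝒢 μ, (𝒢.rightRegular μ).multiplicity P.space.toContRep ≤ 1) ↔
      ∃ S : Set (ClosedSubrep (𝒢.rightRegular μ)), (∀ W ∈ S, W.toContRep.IsTopIrreducible) ∧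
        S.Pairwise (fun W W' => W.toSubmodule ⟂ W'.toSubmodule) ∧ ClosedSubrep.iSupClosure S = ⊤ ∧
        S.Pairwise (fun W W' => Module.finrank ℂ W.toSubmodule ≠ 1 → Module.finrank ℂ W'.toSubmodule ≠ 1 →
          ¬ AreUnitarilyEquivalent W.toContRep W'.toContRep) := by
  rw [forall_multiplicity_le_one_iff_exists_decomposition 𝒢 μ hd]
  constructor
  · rintro ⟨S, hirr, horth, hdense, hne⟩
    exact ⟨S, hirr, horth, hdense, fun W hW W' hW' hWW' _ _ => hne hW hW' hWW'⟩
  · rintro ⟨S, hirr, horth, hdense, hne⟩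
    exact ⟨S, hirr, horth, hdense, pairwise_of_finrank_ne_one 𝒢 μ hirr hne⟩

/-- **E1-shape ⟺ «orthogonal discrete `P, P′` of dimension `≠ 1` are inequivalent»** (discretely decomposable case; the one-dimensional
`P` are handled by ergodicity). This is the form a trace-formula comparison of `L²(U(H))` with its quasi-split inner form delivers.
[cite: Gelbart1975, Thm. 10.10 (proof, p. 158)] [cite: Dixmier1977, 5.4.1 and 5.4.6] -/
theorem forall_multiplicity_le_one_iff_forall_isOrtho_finrank_ne_one (hd : (𝒢.rightRegular μ).IsDiscretelyDecomposable) :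
    (∀ P : DiscreteAutomorphicRep 𝒢 μ, (𝒢.rightRegular μ).multiplicity P.space.toContRep ≤ 1) ↔
      ∀ P P' : DiscreteAutomorphicRep 𝒢 μ, P.space.toSubmodule ⟂ P'.space.toSubmodule →
        Module.finrank ℂ P.space.toSubmodule ≠ 1 → Module.finrank ℂ P'.space.toSubmodule ≠ 1 →
        ¬ AreUnitarilyEquivalent P.space.toContRep P'.space.toContRep := by
  constructor
  · intro h P P' hperp _ _
    exact (forall_multiplicity_le_one_iff_forall_isOrtho 𝒢 μ hd).mp h P P' hperp
  · intro h
    rw [forall_multiplicity_le_one_iff_exists_decomposition_finrank_ne_one 𝒢 μ hd]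
    obtain ⟨S, hirr, horth, hdense⟩ :=
      (𝒢.isUnitary_rightRegular μ).exists_orthogonalDecomposition_of_isDiscretelyDecomposable hd
    exact ⟨S, hirr, horth, hdense, fun W hW W' hW' hWW' h1 h1' =>
      h ⟨W, hirr W hW⟩ ⟨W', hirr W' hW'⟩ (horth hW hW' hWW') h1 h1'⟩

end Generic

/-! ## §2 At the letter binders of E1₂ -/

/-- Under the hypotheses of the letter `curveMultiplicityLeOne` (signature `(1,1)` at `ι`, definite at the other complex places, `[L:ℚ] ≥ 4`)
the automorphic quotient of `U(H)` is compact and the regular representation on `L²(μ)` is discretely decomposable.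
[cite: GelfandGraevPiatetskiShapiro1969, Ch. 1 §2] [cite: DeitmarEchterhoff2014, Thm. 9.2.2] -/
theorem isDiscretelyDecomposable_of_letter (L : Type) [Field L] [NumberField L] [IsCMField L] (ι : L →+* ℂ)
    (H : Matrix (Fin 2) (Fin 2) L) (dV : Fin 2 → L) (t : L) (g : GL (Fin 2) L)
    (hg : formCongr ((IsCMField.complexConj L : L ≃ₐ[↥(maximalRealSubfield L)] L) : L →+* L) g (t • H) = Matrix.diagonal dV)
    (hdef : ∀ τ' : L →+* ℂ, InfinitePlace.mk τ' ≠ InfinitePlace.mk ι → ((Matrix.diagonal dV).map τ').PosDef)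
    (h4 : 4 ≤ Module.finrank ℚ L)
    (μ : Measure (adelicGroupData (↥(maximalRealSubfield L)) L (IsCMField.complexConj L) 2 H).automorphicQuotient)
    [(adelicGroupData (↥(maximalRealSubfield L)) L (IsCMField.complexConj L) 2 H).IsAutomorphicMeasure μ] :
    ((adelicGroupData (↥(maximalRealSubfield L)) L (IsCMField.complexConj L) 2 H).rightRegular μ).IsDiscretelyDecomposable := by
  obtain ⟨τ, hτ⟩ := UnitaryGroup.exists_infinitePlace_ne L h4 ι
  have hanis := S1BettiSliceExclusion.anisotropic_of_formCongr_posDef L H t g dV hg τ (hdef τ hτ)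
  haveI : CompactSpace (adelicGroupData ↥(maximalRealSubfield L) L (IsCMField.complexConj L) 2 H).automorphicQuotient :=
    UnitaryGroup.compactSpace_cmDatum_automorphicQuotient L 2 H hanis
  haveI : LocallyCompactSpace (adelicGroupData ↥(maximalRealSubfield L) L (IsCMField.complexConj L) 2 H).Adelic :=
    UnitaryGroup.locallyCompactSpace_cmDatum_Adelic L 2 H
  haveI : SecondCountableTopology (adelicGroupData ↥(maximalRealSubfield L) L (IsCMField.complexConj L) 2 H).Adelic :=
    UnitaryGroup.secondCountableTopology_cmDatum_Adelic L 2 H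
  exact (adelicGroupData ↥(maximalRealSubfield L) L (IsCMField.complexConj L) 2 H).isDiscretelyDecomposable_rightRegular_of_locallyCompactSpace μ

/-- **THE LETTER E1₂ IN ENGINE CURRENCY.**  `Rogawski1990.curveMultiplicityLeOne` holds iff, for every datum of the letter (`L` CM with
`[L:ℚ] ≥ 4`, `ι`, `H` diagonalised up to the scalar `t` with real non-zero `dV`, signature `(1,1)` at `ι`, definite elsewhere, `μ` automorphic),
NO TWO ORTHOGONAL discrete automorphic representations of `U(H)` OF DIMENSION `≠ 1` are unitarily equivalent.
[cite: Gelbart1975, Thm. 10.10 (proof, p. 158)] [cite: Dixmier1977, 5.4.1 and 5.4.6] -/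
theorem curveMultiplicityLeOne_iff_forall_isOrtho_finrank_ne_one :
    Literature.NumberTheory.Rogawski1990.curveMultiplicityLeOne ↔
      ∀ (L : Type) [Field L] [NumberField L] [IsCMField L] (ι : L →+* ℂ) (H : Matrix (Fin 2) (Fin 2) L)
        (dV : Fin 2 → L) (_hdV : ∀ i, IsCMField.complexConj L (dV i) = dV i) (_hdV0 : ∀ i, dV i ≠ 0)
        (t : L) (_ht : t ≠ 0) (g : GL (Fin 2) L),
        formCongr ((IsCMField.complexConj L : L ≃ₐ[↥(maximalRealSubfield L)] L) : L →+* L) g (t • H) = Matrix.diagonal dV →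
        (∃ T : GL (Fin 2) ℂ, formCongr (starRingEnd ℂ) T ((Matrix.diagonal dV).map ι) = Matrix.diagonal ![(1 : ℂ), -1]) →
        (∀ τ' : L →+* ℂ, InfinitePlace.mk τ' ≠ InfinitePlace.mk ι → ((Matrix.diagonal dV).map τ').PosDef) →
        4 ≤ Module.finrank ℚ L →
        ∀ (μ : Measure (adelicGroupData (↥(maximalRealSubfield L)) L (IsCMField.complexConj L) 2 H).automorphicQuotient)
          [(adelicGroupData (↥(maximalRealSubfield L)) L (IsCMField.complexConj L) 2 H).IsAutomorphicMeasure μ]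
          (P P' : DiscreteAutomorphicRep (adelicGroupData (↥(maximalRealSubfield L)) L (IsCMField.complexConj L) 2 H) μ),
          P.space.toSubmodule ⟂ P'.space.toSubmodule →
          Module.finrank ℂ P.space.toSubmodule ≠ 1 → Module.finrank ℂ P'.space.toSubmodule ≠ 1 →
          ¬ AreUnitarilyEquivalent P.space.toContRep P'.space.toContRep := by
  constructor
  · intro h L _ _ _ ι H dV hdV hdV0 t ht g hg hsig hdef h4 μ _
    haveI : LocallyCompactSpace (adelicGroupData ↥(maximalRealSubfield L) L (IsCMField.complexConj L) 2 H).Adelic :=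
      UnitaryGroup.locallyCompactSpace_cmDatum_Adelic L 2 H
    haveI : SecondCountableTopology (adelicGroupData ↥(maximalRealSubfield L) L (IsCMField.complexConj L) 2 H).Adelic :=
      UnitaryGroup.secondCountableTopology_cmDatum_Adelic L 2 H
    exact (forall_multiplicity_le_one_iff_forall_isOrtho_finrank_ne_one _ μ
      (isDiscretelyDecomposable_of_letter L ι H dV t g hg hdef h4 μ)).mp (h L ι H dV hdV hdV0 t ht g hg hsig hdef h4 μ)
  · intro h L _ _ _ ι H dV hdV hdV0 t ht g hg hsig hdef h4 μ _
    haveI : LocallyCompactSpace (adelicGroupData ↥(maximalRealSubfield L) L (IsCMField.complexConj L) 2 H).Adelic :=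
      UnitaryGroup.locallyCompactSpace_cmDatum_Adelic L 2 H
    haveI : SecondCountableTopology (adelicGroupData ↥(maximalRealSubfield L) L (IsCMField.complexConj L) 2 H).Adelic :=
      UnitaryGroup.secondCountableTopology_cmDatum_Adelic L 2 H
    exact (forall_multiplicity_le_one_iff_forall_isOrtho_finrank_ne_one _ μ
      (isDiscretelyDecomposable_of_letter L ι H dV t g hg hdef h4 μ)).mpr (h L ι H dV hdV hdV0 t ht g hg hsig hdef h4 μ)

/-- **Pointwise form at fixed data** (what an engine proves datum by datum): under the hypotheses of the letter at `(L, ι, H, dV, t, g, μ)`,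
if no two orthogonal discrete automorphic representations of `U(H)` of dimension `≠ 1` are unitarily equivalent, then every discrete `P` has
`multiplicity ≤ 1`. [cite: Gelbart1975, Thm. 10.10 (proof, p. 158)] [cite: Dixmier1977, 5.4.1 and 5.4.6] -/
theorem multiplicity_le_one_of_forall_isOrtho (L : Type) [Field L] [NumberField L] [IsCMField L] (ι : L →+* ℂ)
    (H : Matrix (Fin 2) (Fin 2) L) (dV : Fin 2 → L) (t : L) (g : GL (Fin 2) L)
    (hg : formCongr ((IsCMField.complexConj L : L ≃ₐ[↥(maximalRealSubfield L)] L) : L →+* L) g (t • H) = Matrix.diagonal dV)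
    (hdef : ∀ τ' : L →+* ℂ, InfinitePlace.mk τ' ≠ InfinitePlace.mk ι → ((Matrix.diagonal dV).map τ').PosDef)
    (h4 : 4 ≤ Module.finrank ℚ L)
    (μ : Measure (adelicGroupData (↥(maximalRealSubfield L)) L (IsCMField.complexConj L) 2 H).automorphicQuotient)
    [(adelicGroupData (↥(maximalRealSubfield L)) L (IsCMField.complexConj L) 2 H).IsAutomorphicMeasure μ]
    (h : ∀ P P' : DiscreteAutomorphicRep (adelicGroupData (↥(maximalRealSubfield L)) L (IsCMField.complexConj L) 2 H) μ,
      P.space.toSubmodule ⟂ P'.space.toSubmodule →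
      Module.finrank ℂ P.space.toSubmodule ≠ 1 → Module.finrank ℂ P'.space.toSubmodule ≠ 1 →
      ¬ AreUnitarilyEquivalent P.space.toContRep P'.space.toContRep)
    (P : DiscreteAutomorphicRep (adelicGroupData (↥(maximalRealSubfield L)) L (IsCMField.complexConj L) 2 H) μ) :
    ((adelicGroupData (↥(maximalRealSubfield L)) L (IsCMField.complexConj L) 2 H).rightRegular μ).multiplicity P.space.toContRep ≤ 1 := by
  haveI : LocallyCompactSpace (adelicGroupData ↥(maximalRealSubfield L) L (IsCMField.complexConj L) 2 H).Adelic :=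
    UnitaryGroup.locallyCompactSpace_cmDatum_Adelic L 2 H
  haveI : SecondCountableTopology (adelicGroupData ↥(maximalRealSubfield L) L (IsCMField.complexConj L) 2 H).Adelic :=
    UnitaryGroup.secondCountableTopology_cmDatum_Adelic L 2 H
  exact (forall_multiplicity_le_one_iff_forall_isOrtho_finrank_ne_one _ μ
    (isDiscretelyDecomposable_of_letter L ι H dV t g hg hdef h4 μ)).mpr h P

end Summit.HodgeConjecture.HodgeConjecture.Cruxes.HLiu418.E1Criterion

end
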